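import Summits.Langlands.Langlands.Theses.HybridParityDefect
import Literature.NumberTheory.GaloisRepresentations.ArtinReciprocityCharacterProofs
import Literature.NumberTheory.GaloisRepresentations.FramedRepDualIrreducible
import Literature.NumberTheory.GaloisRepresentations.GoodDihedralLocalImage
import Literature.NumberTheory.GaloisRepresentations.GaloisRepUnramifiedProofs
import Literature.FieldTheory.AlgClosed.PadicAlgClEquivComplex
import Literature.NumberTheory.Automorphic.LanglandsTetrahedral

/-!
# `HybridParityDefect.ArtinAvatarSupply` — the `ℓ`-adic avatar of the contragredient of an
Artin representation (route item `stmt-Langlands-17968`, proved outright)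

The item asks: for every number field `F`, every framed Artin representation
`σ : Γ_F →ₜ* GL₂(ℂ)` in the mixed-parity icosahedral class `MixedIco` and every reciprocity datum
`𝓡 : ReciprocityData F`, there are a prime `ℓ`, a field isomorphism `ι : ℚ̄_ℓ ≃+* ℂ` and a framed
`ℓ`-adic representation `ρ : Γ_F →ₜ* GL₂(ℚ̄_ℓ)` with `ι((ρ g)⁻ᵀ) = σ g` for all `g`
(`DualAvatar`), `ρ` irreducible, and `ρ` geometric in the summit's sense
(`Summit.Langlands.IsGeometricFramed 𝓡 ρ`: unramified almost everywhere and de Rham at every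
`v ∣ ℓ` for the pinned Fontaine datum `𝓡.pst ℓ v`).

## Proof

* **Choice of `ℓ`.**  An Artin representation is unramified outside a finite set `S` of places
  (`FramedArtinRep.eventually_isUnramifiedAt`, from the open kernel).  Take a rational prime `ℓ`
  larger than every absolute norm `N(𝔭_v)`, `v ∈ S`; then no `v ∣ ℓ` lies in `S`: if
  `ℓ ∈ 𝔭_v` then `ℓ ∣ N(𝔭_v)` (else `ℓ` and `N(𝔭_v) ∈ 𝔭_v` are coprime and `1 ∈ 𝔭_v`), so
  `N(𝔭_v) ≥ ℓ` (`exists_prime_forall_isUnramifiedAt`).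
* **The avatar.**  With `ι : ℚ̄_ℓ ≃+* ℂ` (`PadicAlgCl.nonempty_ringEquiv_complex`) put
  `ρ := GL₂(ι⁻¹) ∘ σ^∨`, `σ^∨ = (σ⁻¹)ᵀ` the contragredient (`FramedRep.dual`).  It is continuous
  although `ι⁻¹` is not, because its kernel contains the open kernel of `σ`
  (`FramedArtinRep.isOpen_ker_toMonoidHom`, `MonoidHom.continuous_of_isOpen_ker`); and
  `ι((ρ g)⁻ᵀ) = ι(ι⁻¹(((σ g)⁻ᵀ)⁻ᵀ)) = σ g` (`transpose_map_inv_avatar`).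
* **Irreducibility.**  `σ^∨` is irreducible with `σ` (`FramedRep.isIrreducible_dual`), and in rank
  two irreducibility is the absence of a common eigenvector
  (`isIrreducible_iff_not_hasCommonEigenvector`), a property transported along the field
  isomorphism `ι` (`hasCommonEigenvector_map`).
* **Geometricity.**  Unramifiedness passes from `σ` to `ρ` pointwise on inertia
  (`isUnramifiedAt_avatar`), so `ρ` is unramified almost everywhere and at every `v ∣ ℓ`; at such
  `v` the local representation is trivial on the inertia group of `F_v`
  (`GaloisRep.isUnramifiedAt_iff_toLocal_holds`) and an unramified representation is de Rham for
  every `PstWeilDeligneData` (`PstWeilDeligneData.isDeRhamFramed_of_isLocallyUnramified`) — the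
  argument of the landed sibling `QuarterDeficit1951IcosahedralSupplyAway`
  (`isGeometricFramed_of_isUnramifiedAt`).

Only the irreducibility conjunct of `MixedIco` is used; finiteness of the image, insolubility
and the signature conditions are not needed for the supply.

References: Deligne–Serre, *Formes modulaires de poids 1*, Ann. Sci. ÉNS 7 (1974), §8.7
(complex and `ℓ`-adic avatars of a finite-image representation); Serre, *Abelian `ℓ`-adic
representations* (1968), Ch. I §2.1; Fontaine–Mazur (1995), §1.
-/

set_option linter.dupNamespace false -- project-wide option (lakefile weak.linter.dupNamespace); `Summit.Langlands.Langlands` is the mandated namespace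

noncomputable section

open scoped NumberField MatrixGroups
open IsDedekindDomain Field Literature.NumberTheory.GaloisRepresentations

namespace Summit.Langlands.Langlands.Theorems.HybridParityDefectArtinAvatarSupply

universe u v w

/-! ### The `ℓ`-adic avatar `GL_n(ι⁻¹) ∘ σ^∨` of the contragredient -/

section Avatar

variable {F : Type} [Field F] [NumberField F] {n : ℕ} {ℓ : ℕ} [Fact ℓ.Prime]

/-- **The avatar exists as a continuous homomorphism.**  For a framed Artin representation
`σ : Γ_F →ₜ* GL_n(ℂ)` and any field isomorphism `ι : ℚ̄_ℓ ≃+* ℂ`, the homomorphism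
`g ↦ GL_n(ι⁻¹)((σ g)⁻ᵀ)` is continuous: its kernel contains the open kernel of `σ`
(`FramedArtinRep.isOpen_ker_toMonoidHom`).  Deligne–Serre 1974, §8.7. [folklore] -/
theorem exists_avatar (σ : FramedArtinRep F n) (ι : PadicAlgCl ℓ ≃+* ℂ) :
    ∃ ρ : FramedGaloisRep F (PadicAlgCl ℓ) n,
      ∀ g, ρ g = Matrix.GeneralLinearGroup.map (ι.symm : ℂ →+* PadicAlgCl ℓ)
        (FramedRep.dual σ g) := by
  let f : absoluteGaloisGroup F →* GL (Fin n) (PadicAlgCl ℓ) :=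
    (Matrix.GeneralLinearGroup.map (ι.symm : ℂ →+* PadicAlgCl ℓ)).comp
      (FramedRep.dual σ).toMonoidHom
  have hle : σ.toMonoidHom.ker ≤ f.ker := by
    intro g hg
    rw [MonoidHom.mem_ker] at hg ⊢
    have hg' : σ g = 1 := hg
    have hd : FramedRep.dual σ g = 1 := by
      show glTransposeInv (Fin n) ℂ (σ g) = 1
      rw [hg', map_one]
    show Matrix.GeneralLinearGroup.map (ι.symm : ℂ →+* PadicAlgCl ℓ) (FramedRep.dual σ g) = 1
    rw [hd, map_one]
  have hopen : IsOpen (f.ker : Set (absoluteGaloisGroup F)) :=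
    Subgroup.isOpen_mono hle (FramedArtinRep.isOpen_ker_toMonoidHom σ)
  exact ⟨⟨f, Literature.NumberTheory.Automorphic.MonoidHom.continuous_of_isOpen_ker f hopen⟩,
    fun g => rfl⟩

variable {σ : FramedArtinRep F n} {ρ : FramedGaloisRep F (PadicAlgCl ℓ) n} (ι : PadicAlgCl ℓ ≃+* ℂ)

omit [NumberField F] in
/-- **The avatar relation `ι((ρ g)⁻ᵀ) = σ g`:** with `ρ g = GL_n(ι⁻¹)((σ g)⁻ᵀ)` one has
`((ρ g)⁻¹)ᵀ = GL_n(ι⁻¹)(σ g)`, and applying `ι` entrywise returns `σ g`. [folklore] -/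
theorem transpose_map_inv_avatar
    (hρ : ∀ g, ρ g = Matrix.GeneralLinearGroup.map (ι.symm : ℂ →+* PadicAlgCl ℓ)
      (FramedRep.dual σ g)) (g : absoluteGaloisGroup F) :
    (((ρ g)⁻¹ : GL (Fin n) (PadicAlgCl ℓ)) : Matrix (Fin n) (Fin n) (PadicAlgCl ℓ)).transpose.map ι =
      ((σ g : GL (Fin n) ℂ) : Matrix (Fin n) (Fin n) ℂ) := by
  have h1 : (ρ g)⁻¹ = Matrix.GeneralLinearGroup.map (ι.symm : ℂ →+* PadicAlgCl ℓ)
      (FramedRep.dual σ g⁻¹) := by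
    rw [map_inv (FramedRep.dual σ) g, map_inv (Matrix.GeneralLinearGroup.map _), ← hρ g]
  rw [h1]
  ext i j
  rw [Matrix.map_apply, Matrix.transpose_apply, Matrix.GeneralLinearGroup.map_apply,
    FramedRep.coe_dual_apply_inv, Matrix.transpose_apply]
  simp

omit [NumberField F] in
/-- **Unramifiedness passes to the avatar**: if `σ` is trivial on an inertia group then so is
`ρ = GL_n(ι⁻¹) ∘ σ^∨`. [folklore] -/
theorem isUnramifiedAt_avatar
    (hρ : ∀ g, ρ g = Matrix.GeneralLinearGroup.map (ι.symm : ℂ →+* PadicAlgCl ℓ)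
      (FramedRep.dual σ g)) {v : HeightOneSpectrum (𝓞 F)} (h : σ.IsUnramifiedAt v) :
    ρ.IsUnramifiedAt v := by
  intro 𝔓 h𝔓 τ hτ
  rw [hρ τ]
  have h1 : σ τ = 1 := h 𝔓 h𝔓 τ hτ
  have hd : FramedRep.dual σ τ = 1 := by
    show glTransposeInv (Fin n) ℂ (σ τ) = 1
    rw [h1, map_one]
  rw [hd, map_one]

end Avatar

/-! ### Irreducibility of the avatar (rank two) -/

section Eigen

variable {G : Type*} [Group G] {k : Type v} [Field k] {k' : Type w} [Field k']

/-- A common eigenvector of `ρ(G) ≤ GL₂(k)` is pushed along any field homomorphism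
`φ : k →+* k'` to one of `GL₂(φ) ∘ ρ`. [folklore] -/
theorem hasCommonEigenvector_map (φ : k →+* k') {τ : G →* GL (Fin 2) k}
    (h : HasCommonEigenvector τ) :
    HasCommonEigenvector ((Matrix.GeneralLinearGroup.map φ).comp τ) := by
  obtain ⟨v, hv0, key⟩ := h
  refine ⟨fun i => φ (v i), ?_, fun g => ?_⟩
  · intro h0
    apply hv0
    funext i
    have hi := congrFun h0 i
    simp only [Pi.zero_apply, map_eq_zero] at hi
    exact hi
  · obtain ⟨a, ha⟩ := key g
    refine ⟨φ a, ?_⟩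
    funext i
    have hi := congrFun ha i
    simp only [Matrix.mulVec, dotProduct, Fin.sum_univ_two, Pi.smul_apply, smul_eq_mul] at hi ⊢
    rw [MonoidHom.comp_apply]
    simp only [Matrix.GeneralLinearGroup.map_apply]
    rw [← map_mul, ← map_mul, ← map_add, hi, map_mul]

end Eigen

section Irreducible

variable {F : Type} [Field F] [NumberField F] {ℓ : ℕ} [Fact ℓ.Prime]
  {σ : FramedArtinRep F 2} {ρ : FramedGaloisRep F (PadicAlgCl ℓ) 2} (ι : PadicAlgCl ℓ ≃+* ℂ)

omit [NumberField F] in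
/-- **The avatar of an irreducible `σ` is irreducible.**  The contragredient `σ^∨` is irreducible
(`FramedRep.isIrreducible_dual`), hence has no common eigenvector in `ℂ²`
(`isIrreducible_iff_not_hasCommonEigenvector`); a common eigenvector of `ρ = GL₂(ι⁻¹) ∘ σ^∨` in
`ℚ̄_ℓ²` would map under `ι` to one of `GL₂(ι) ∘ ρ = σ^∨`. [folklore] -/
theorem isIrreducible_avatar
    (hρ : ∀ g, ρ g = Matrix.GeneralLinearGroup.map (ι.symm : ℂ →+* PadicAlgCl ℓ)
      (FramedRep.dual σ g)) (hirr : σ.toGaloisRep.IsIrreducible) :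
    ρ.toGaloisRep.IsIrreducible := by
  have hσ : σ.IsIrreducible := (FramedRep.isIrreducible_toContinuousRep_iff σ).1 hirr
  have hdual : (FramedRep.dual σ).IsIrreducible := FramedRep.isIrreducible_dual σ hσ
  have hnce : ¬ HasCommonEigenvector (FramedRep.dual σ).toMonoidHom := by
    refine not_hasCommonEigenvector_of_isIrreducible _ ?_
    rw [toStdRepresentation_toMonoidHom]
    exact hdual
  have hcomp : (Matrix.GeneralLinearGroup.map (ι : PadicAlgCl ℓ →+* ℂ)).comp ρ.toMonoidHom =
      (FramedRep.dual σ).toMonoidHom := by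
    refine MonoidHom.ext fun g => Units.ext (Matrix.ext fun i j => ?_)
    rw [MonoidHom.comp_apply, Matrix.GeneralLinearGroup.map_apply]
    have e : ρ.toMonoidHom g = ρ g := rfl
    have e' : (FramedRep.dual σ).toMonoidHom g = FramedRep.dual σ g := rfl
    rw [e, e', hρ g, Matrix.GeneralLinearGroup.map_apply]
    simp
  have hnce' : ¬ HasCommonEigenvector ρ.toMonoidHom := by
    intro h
    apply hnce
    rw [← hcomp]
    exact hasCommonEigenvector_map _ h
  have h := isIrreducible_of_not_hasCommonEigenvector _ hnce'
  rw [toStdRepresentation_toMonoidHom] at h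
  exact (FramedRep.isIrreducible_toContinuousRep_iff ρ).2 h

end Irreducible

/-! ### A prime `ℓ` above which `σ` is unramified, and geometricity -/

section Geometric

variable {F : Type} [Field F] [NumberField F] {n : ℕ}

/-- **A prime of good reduction for an Artin representation.**  There is a rational prime `ℓ`
such that `σ` is unramified at every place `v` of `F` above `ℓ`: `σ` ramifies at finitely many
`v` (`FramedArtinRep.eventually_isUnramifiedAt`), and a prime `ℓ` exceeding all their absolute
norms `N(𝔭_v)` lies in no such `𝔭_v` (`ℓ ∈ 𝔭_v` forces `ℓ ∣ N(𝔭_v)`, since otherwise `ℓ` and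
`N(𝔭_v) ∈ 𝔭_v` would be coprime).  Serre, *Abelian ℓ-adic representations*, Ch. I §2.1.
[folklore] -/
theorem exists_prime_forall_isUnramifiedAt (σ : FramedArtinRep F n) :
    ∃ ℓ : ℕ, ℓ.Prime ∧
      ∀ v : HeightOneSpectrum (𝓞 F), ((ℓ : ℕ) : 𝓞 F) ∈ v.asIdeal → σ.IsUnramifiedAt v := by
  classical
  have hS : {v : HeightOneSpectrum (𝓞 F) | ¬ σ.IsUnramifiedAt v}.Finite :=
    Filter.eventually_cofinite.1 (FramedArtinRep.eventually_isUnramifiedAt σ)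
  obtain ⟨ℓ, hMℓ, hℓ⟩ :=
    Nat.exists_infinite_primes (hS.toFinset.sup (fun v => Ideal.absNorm v.asIdeal) + 1)
  refine ⟨ℓ, hℓ, fun v hv => ?_⟩
  by_contra hram
  have hvS : v ∈ hS.toFinset := hS.mem_toFinset.2 hram
  have hle : Ideal.absNorm v.asIdeal ≤ hS.toFinset.sup (fun v => Ideal.absNorm v.asIdeal) :=
    Finset.le_sup (f := fun v : HeightOneSpectrum (𝓞 F) => Ideal.absNorm v.asIdeal) hvS
  have hdvd : ℓ ∣ Ideal.absNorm v.asIdeal := by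
    by_contra hnd
    have hcop : Nat.Coprime ℓ (Ideal.absNorm v.asIdeal) := hℓ.coprime_iff_not_dvd.2 hnd
    obtain ⟨a, b, hab⟩ := hcop.cast (R := 𝓞 F)
    have h1 : (1 : 𝓞 F) ∈ v.asIdeal := by
      rw [← hab]
      exact v.asIdeal.add_mem (v.asIdeal.mul_mem_left a hv)
        (v.asIdeal.mul_mem_left b (Ideal.absNorm_mem v.asIdeal))
    exact v.isPrime.ne_top ((Ideal.eq_top_iff_one _).2 h1)
  have hne : Ideal.absNorm v.asIdeal ≠ 0 := by
    rw [Ne, Ideal.absNorm_eq_zero_iff]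
    exact v.ne_bot
  have hle' : ℓ ≤ Ideal.absNorm v.asIdeal := Nat.le_of_dvd (Nat.pos_of_ne_zero hne) hdvd
  omega

/-- **Unramified above `ℓ` ⇒ geometric in the summit's sense.**  A framed `ℓ`-adic
representation unramified almost everywhere and at every `v ∣ ℓ` satisfies
`Summit.Langlands.IsGeometricFramed 𝓡 ρ` for every reciprocity datum `𝓡`: at `v ∣ ℓ` the local
representation `ρ|Γ_{F_v}` is trivial on the inertia group of `F_v`
(`GaloisRep.isUnramifiedAt_iff_toLocal_holds`), and an unramified representation is de Rham for
the pinned datum (`PstWeilDeligneData.isDeRhamFramed_of_isLocallyUnramified`, Fontaine,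
Astérisque 223, Exp. III §5 / Exp. VIII).  Same argument as the landed
`QuarterDeficit1951.isGeometricFramed_of_unramified_away`. [folklore] -/
theorem isGeometricFramed_of_isUnramifiedAt {ℓ : ℕ} [Fact ℓ.Prime]
    (RD : Summit.Langlands.ReciprocityData F) (ρ : FramedGaloisRep F (PadicAlgCl ℓ) n)
    (hcof : ∀ᶠ v : HeightOneSpectrum (𝓞 F) in Filter.cofinite, ρ.IsUnramifiedAt v)
    (hℓ : ∀ v : HeightOneSpectrum (𝓞 F), ((ℓ : ℕ) : 𝓞 F) ∈ v.asIdeal → ρ.IsUnramifiedAt v) :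
    Summit.Langlands.IsGeometricFramed RD ρ := by
  refine ⟨hcof, fun v hv => ?_⟩
  apply PstWeilDeligneData.isDeRhamFramed_of_isLocallyUnramified
  have h : ρ.IsUnramifiedAt v := hℓ v hv
  intro σ hσ
  have h1 := (GaloisRep.isUnramifiedAt_iff_toLocal_holds v ρ.toGaloisRep).1
    ((FramedGaloisRep.isUnramifiedAt_toGaloisRep_iff v ρ).2 h) σ hσ
  have h2 : Matrix.toLin' (((ρ.toLocal v) σ : GL (Fin n) (PadicAlgCl ℓ)) :
      Matrix (Fin n) (Fin n) (PadicAlgCl ℓ)) = Matrix.toLin' 1 := by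
    rw [Matrix.toLin'_one]
    refine LinearMap.ext fun w => ?_
    simpa using congr($h1 w)
  exact Units.ext (Matrix.toLin'.injective h2)

end Geometric

/-! ### The item -/

/-- **`ArtinAvatarSupply` holds** (route `HybridParityDefect`, support item `stmt-Langlands-17968`):
every mixed-parity icosahedral `σ : Γ_F →ₜ* GL₂(ℂ)` has, for every reciprocity datum `𝓡` of `F`, a
prime `ℓ` (any prime above which `σ` is unramified), a field isomorphism `ι : ℚ̄_ℓ ≃+* ℂ` and the
framed `ℓ`-adic avatar `ρ = GL₂(ι⁻¹) ∘ σ^∨` of the contragredient, with `ι((ρ g)⁻ᵀ) = σ g`,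
irreducible, and geometric in the summit's sense.  Deligne–Serre (1974) §8.7; Fontaine–Mazur
(1995) §1 (Artin representations are geometric). [folklore] -/
theorem artinAvatarSupply :
    Summit.Langlands.Langlands.Theses.HybridParityDefect.ArtinAvatarSupply := by
  intro F _ _ ι₁ ι₂ σ hMix RD
  have hirrσ : σ.toGaloisRep.IsIrreducible := hMix.1
  obtain ⟨ℓ, hℓ, hunr⟩ := exists_prime_forall_isUnramifiedAt σ
  haveI hF : Fact ℓ.Prime := ⟨hℓ⟩
  obtain ⟨ι⟩ := PadicAlgCl.nonempty_ringEquiv_complex ℓ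
  obtain ⟨ρ, hρ⟩ := exists_avatar σ ι
  refine ⟨ℓ, hF, ι, ρ, ?_, ?_, ?_⟩
  · intro g
    exact transpose_map_inv_avatar ι hρ g
  · exact isIrreducible_avatar ι hρ hirrσ
  · exact isGeometricFramed_of_isUnramifiedAt RD ρ
      ((FramedArtinRep.eventually_isUnramifiedAt σ).mono fun v hv => isUnramifiedAt_avatar ι hρ hv)
      (fun v hv => isUnramifiedAt_avatar ι hρ (hunr v hv))

end Summit.Langlands.Langlands.Theorems.HybridParityDefectArtinAvatarSupply

end
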